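import Summits.CriticalPhenomena.PercolationContinuityZ3.Theorems.PercNearOneGluingNoHeavyLowerTailSunflowerRestrictionNoLiftedRainbow
import HarnessLib

/-!
# `NoHeavyLowerTail` (crux stmt-CriticalPhenomena-4575), abstract sunflower cubic: the DUAL restriction inequality `3T₂ ≥ T₃` and the cell `T₂ ≥ 0`
# (chain-polarised sums with offsets `({e},{e},∅)`) at every coordinate creating no doubly-lifted rainbow

Support file (seat `prim-l12-p2` gen 8; `--supports stmt-CriticalPhenomena-4575`; companion of `…SunflowerRestrictionTwoPetal` (p225252),
`…SunflowerRestrictionNoLiftedRainbow` (p226120), `…SunflowerPartitionReduction` (p217435)).  Memo: run/shared/lean/prim/prim-l12/prim-l12-p2/FINDING-g8-MZ-PETAL-FREE.md §6.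
Nothing is asserted about the crux; no `sorry`.

SETTING.  `F : Sunflower α`, `e ∉ W`, sections `φ = lab`, `ψX = lab (insert e X)` on `2^W`, and the lift sums `T₂ = Σ s6H(ψX, ψS, φT) = F.ZP W {e} {e} ∅`,
`T₃ = Σ s6H(ψ,ψ,ψ) = F.ZP W {e} {e} {e}` (chain-polarised partition sums of `…SunflowerPartitionReduction` with offsets `{e} ⊇ {e} ⊇ ∅`).  The inequality `3T₂ ≥ T₃`
is the ⊤-dual of restriction monotonicity `3T₁ ≥ T₀` (seat prim-l12-p2 g6; = the `k e = 7` clause of prove-1's `Retention3`), and `T₂ ≥ 0` is the instance `({e},{e},∅)` of the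
typed conjecture `ChainPolarisedPartitionLemma` (P3); by the clone identity `Z(Φ with e doubled) = 3T₁ + 6T₂` (g6 memo §3), `T₂ ≥ 0` is ALSO restriction monotonicity at a
coordinate that has a twin.  A DOUBLY-LIFTED RAINBOW is an ordered 3-partition `(X,S,T)` of `W` with `ψX, ψS, φT` three distinct petals.

MAIN RESULTS (this work): if `e` creates no doubly-lifted rainbow on `2^W`, then
* `Sunflower.ZP_pair_offset_nonneg_of_no_double_rainbow`: `0 ≤ F.ZP W {e} {e} ∅` (`T₂ ≥ 0`), and
* `Sunflower.ZP_triple_le_three_ZP_pair_of_no_double_rainbow`: `F.ZP W {e} {e} {e} ≤ 3 · F.ZP W {e} {e} ∅` (`3T₂ ≥ T₃`).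
Proof: spectator form (`s6H_eq_spec`): `T₂ = 2P + Q − N110`, `T₃ = 3R − N111 ≤ 3R` with `P = Σ_X sp(ψX)σ₁₀`, `Q = Σ_X sp(φX)σ₁₁`, `R = Σ_X sp(ψX)σ₁₁`
(block symmetries `nested_swap12/23`), all `σ ≥ 0` (antipodal Gladkov with offsets), and `σ₁₁ ≤ 2σ₁₀` (summed `kk` exchange, `Sunflower.antipodal_insert_insert_le_two_mul_insert`),
whence `R ≤ 2P + Q` termwise in the spectator.  Together with p226120 (`3T₁ ≥ T₀` without lifted rainbows): all four facets `T₀ ≥ 0, T₃ ≥ 0, 3T₁ ≥ T₀, 3T₂ ≥ T₃` of the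
realisable lift cone (g6) are rainbow-payment statements, proved here whenever the corresponding rainbow count vanishes.
-/

namespace Summit.CriticalPhenomena.PercolationContinuityZ3.Theorems.SunflowerPartition

open Finset

variable {α : Type*} [DecidableEq α]

namespace Sunflower

variable (F : Sunflower α)

/-- `σ₁₁ ≤ 2σ₁₀`: companion of `antipodal_le_two_mul_insert` (summed `kk` exchange plus `0 ≤ σ₀₀`). [this work] -/
theorem antipodal_insert_insert_le_two_mul_insert (U : Finset α) (e : α) :
    ∑ S ∈ U.powerset, kk (F.lab (insert e S)) (F.lab (insert e (U \ S)))
      ≤ 2 * ∑ S ∈ U.powerset, kk (F.lab (insert e S)) (F.lab (U \ S)) := by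
  have hpt : ∀ S ∈ U.powerset,
      kk (F.lab S) (F.lab (U \ S)) + kk (F.lab (insert e S)) (F.lab (insert e (U \ S)))
        ≤ kk (F.lab (insert e S)) (F.lab (U \ S)) + kk (F.lab S) (F.lab (insert e (U \ S))) :=
    fun S _ => kk_submod _ _ _ _ (F.lab_mono (subset_insert e S)) (F.lab_mono (subset_insert e (U \ S)))
  have hsum := sum_le_sum hpt
  rw [sum_add_distrib, sum_add_distrib] at hsum
  have hsym : ∑ S ∈ U.powerset, kk (F.lab S) (F.lab (insert e (U \ S)))
      = ∑ S ∈ U.powerset, kk (F.lab (insert e S)) (F.lab (U \ S)) := by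
    refine sum_nbij' (fun S => U \ S) (fun S => U \ S) ?_ ?_ ?_ ?_ ?_
    · intro S _; exact mem_powerset.2 sdiff_subset
    · intro S _; exact mem_powerset.2 sdiff_subset
    · intro S hS; exact Finset.sdiff_sdiff_eq_self (mem_powerset.1 hS)
    · intro S hS; exact Finset.sdiff_sdiff_eq_self (mem_powerset.1 hS)
    · intro S hS; rw [Finset.sdiff_sdiff_eq_self (mem_powerset.1 hS), kk_comm]
  have h00 := F.antipodal_gladkov U
  linarith

/-- `F.ZP W {e} {e} ∅` is the nested sum `Σ s6H (ψX) (ψS) (φT)` (`T₂`). [this work] -/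
theorem ZP_pair_offset_eq_nested (W : Finset α) (e : α) :
    F.ZP W {e} {e} ∅ = nested W (fun X S T => s6H (F.lab (insert e X)) (F.lab (insert e S)) (F.lab T)) := by
  rw [nested_eq_sum_filter]
  unfold Sunflower.ZP partsOf
  refine sum_congr rfl fun q _ => ?_
  rw [← insert_eq, ← insert_eq, empty_union]

/-- `F.ZP W {e} {e} {e}` is the nested sum `Σ s6H (ψX) (ψS) (ψT)` (`T₃`, the partition functional of the upper section). [this work] -/
theorem ZP_triple_offset_eq_nested (W : Finset α) (e : α) :
    F.ZP W {e} {e} {e} = nested W (fun X S T => s6H (F.lab (insert e X)) (F.lab (insert e S)) (F.lab (insert e T))) := by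
  rw [nested_eq_sum_filter]
  unfold Sunflower.ZP partsOf
  refine sum_congr rfl fun q _ => ?_
  rw [← insert_eq, ← insert_eq, ← insert_eq]

/-- Spectator decomposition of `T₂` without doubly-lifted rainbows: `T₂ = 2P + Q`. [this work] -/
theorem nested_T2_eq_of_no_double_rainbow (W : Finset α) (e : α)
    (hnr : ∀ X ∈ W.powerset, ∀ S ∈ (W \ X).powerset, triP (F.lab (insert e X)) (F.lab (insert e S)) (F.lab ((W \ X) \ S)) = 0) :
    nested W (fun X S T => s6H (F.lab (insert e X)) (F.lab (insert e S)) (F.lab T))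
      = 2 * nested W (fun X S T => (if F.lab (insert e X) = 0 ∨ F.lab (insert e X) = 4 then (1 : ℤ) else 0) * kk (F.lab (insert e S)) (F.lab T))
        + nested W (fun X S T => (if F.lab X = 0 ∨ F.lab X = 4 then (1 : ℤ) else 0) * kk (F.lab (insert e S)) (F.lab (insert e T))) := by
  have step : nested W (fun X S T => s6H (F.lab (insert e X)) (F.lab (insert e S)) (F.lab T))
      = nested W (fun X S T => (if F.lab (insert e X) = 0 ∨ F.lab (insert e X) = 4 then (1 : ℤ) else 0) * kk (F.lab (insert e S)) (F.lab T))
        + nested W (fun X S T => (if F.lab (insert e S) = 0 ∨ F.lab (insert e S) = 4 then (1 : ℤ) else 0) * kk (F.lab (insert e X)) (F.lab T))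
        + nested W (fun X S T => (if F.lab T = 0 ∨ F.lab T = 4 then (1 : ℤ) else 0) * kk (F.lab (insert e X)) (F.lab (insert e S))) := by
    unfold nested
    rw [← sum_add_distrib, ← sum_add_distrib]
    refine sum_congr rfl fun X hX => ?_
    rw [← sum_add_distrib, ← sum_add_distrib]
    refine sum_congr rfl fun S hS => ?_
    have h := s6H_eq_spec (F.lab (insert e X)) (F.lab (insert e S)) (F.lab ((W \ X) \ S))
    rw [hnr X hX S hS, sub_zero] at h
    exact h
  have e2 : nested W (fun X S T => (if F.lab (insert e S) = 0 ∨ F.lab (insert e S) = 4 then (1 : ℤ) else 0) * kk (F.lab (insert e X)) (F.lab T))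
      = nested W (fun X S T => (if F.lab (insert e X) = 0 ∨ F.lab (insert e X) = 4 then (1 : ℤ) else 0) * kk (F.lab (insert e S)) (F.lab T)) := by
    rw [nested_swap12]
  have e3 : nested W (fun X S T => (if F.lab T = 0 ∨ F.lab T = 4 then (1 : ℤ) else 0) * kk (F.lab (insert e X)) (F.lab (insert e S)))
      = nested W (fun X S T => (if F.lab X = 0 ∨ F.lab X = 4 then (1 : ℤ) else 0) * kk (F.lab (insert e S)) (F.lab (insert e T))) := by
    rw [nested_swap23, nested_swap12]
  rw [step, e2, e3]
  ring

/-- **`T₂ ≥ 0` without doubly-lifted rainbows** (this work): `0 ≤ F.ZP W {e} {e} ∅` — an instance of the chain-polarised partition lemma (P3) with offsets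
`({e},{e},∅)`, and restriction monotonicity at a coordinate with a twin. -/
theorem ZP_pair_offset_nonneg_of_no_double_rainbow (W : Finset α) (e : α)
    (hnr : ∀ X ∈ W.powerset, ∀ S ∈ (W \ X).powerset, triP (F.lab (insert e X)) (F.lab (insert e S)) (F.lab ((W \ X) \ S)) = 0) :
    0 ≤ F.ZP W {e} {e} ∅ := by
  rw [F.ZP_pair_offset_eq_nested, F.nested_T2_eq_of_no_double_rainbow W e hnr]
  have hP : 0 ≤ nested W (fun X S T => (if F.lab (insert e X) = 0 ∨ F.lab (insert e X) = 4 then (1 : ℤ) else 0) * kk (F.lab (insert e S)) (F.lab T)) := by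
    unfold nested
    refine sum_nonneg fun X _ => ?_
    rw [← mul_sum]
    refine mul_nonneg ?_ (F.antipodal_insert_nonneg (W \ X) e)
    split_ifs <;> norm_num
  have hQ : 0 ≤ nested W (fun X S T => (if F.lab X = 0 ∨ F.lab X = 4 then (1 : ℤ) else 0) * kk (F.lab (insert e S)) (F.lab (insert e T))) := by
    unfold nested
    refine sum_nonneg fun X _ => ?_
    rw [← mul_sum]
    refine mul_nonneg ?_ (F.antipodal_insert_insert_nonneg (W \ X) e)
    split_ifs <;> norm_num
  linarith

/-- **Dual restriction inequality `3T₂ ≥ T₃` without doubly-lifted rainbows** (this work): `F.ZP W {e} {e} {e} ≤ 3 · F.ZP W {e} {e} ∅`. -/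
theorem ZP_triple_le_three_ZP_pair_of_no_double_rainbow (W : Finset α) (e : α)
    (hnr : ∀ X ∈ W.powerset, ∀ S ∈ (W \ X).powerset, triP (F.lab (insert e X)) (F.lab (insert e S)) (F.lab ((W \ X) \ S)) = 0) :
    F.ZP W {e} {e} {e} ≤ 3 * F.ZP W {e} {e} ∅ := by
  rw [F.ZP_pair_offset_eq_nested, F.nested_T2_eq_of_no_double_rainbow W e hnr, F.ZP_triple_offset_eq_nested]
  -- `T₃ ≤ 3R`
  have hT3 : nested W (fun X S T => s6H (F.lab (insert e X)) (F.lab (insert e S)) (F.lab (insert e T)))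
      ≤ 3 * nested W (fun X S T => (if F.lab (insert e X) = 0 ∨ F.lab (insert e X) = 4 then (1 : ℤ) else 0)
          * kk (F.lab (insert e S)) (F.lab (insert e T))) := by
    have step : nested W (fun X S T => s6H (F.lab (insert e X)) (F.lab (insert e S)) (F.lab (insert e T)))
        = nested W (fun X S T => (if F.lab (insert e X) = 0 ∨ F.lab (insert e X) = 4 then (1 : ℤ) else 0) * kk (F.lab (insert e S)) (F.lab (insert e T)))
          + nested W (fun X S T => (if F.lab (insert e S) = 0 ∨ F.lab (insert e S) = 4 then (1 : ℤ) else 0) * kk (F.lab (insert e X)) (F.lab (insert e T)))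
          + nested W (fun X S T => (if F.lab (insert e T) = 0 ∨ F.lab (insert e T) = 4 then (1 : ℤ) else 0) * kk (F.lab (insert e X)) (F.lab (insert e S)))
          - nested W (fun X S T => triP (F.lab (insert e X)) (F.lab (insert e S)) (F.lab (insert e T))) := by
      unfold nested
      rw [← sum_add_distrib, ← sum_add_distrib, ← sum_sub_distrib]
      refine sum_congr rfl fun X _ => ?_
      rw [← sum_add_distrib, ← sum_add_distrib, ← sum_sub_distrib]
      refine sum_congr rfl fun S _ => ?_
      exact s6H_eq_spec _ _ _
    have e2 : nested W (fun X S T => (if F.lab (insert e S) = 0 ∨ F.lab (insert e S) = 4 then (1 : ℤ) else 0) * kk (F.lab (insert e X)) (F.lab (insert e T)))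
        = nested W (fun X S T => (if F.lab (insert e X) = 0 ∨ F.lab (insert e X) = 4 then (1 : ℤ) else 0) * kk (F.lab (insert e S)) (F.lab (insert e T))) := by
      rw [nested_swap12]
    have e3 : nested W (fun X S T => (if F.lab (insert e T) = 0 ∨ F.lab (insert e T) = 4 then (1 : ℤ) else 0) * kk (F.lab (insert e X)) (F.lab (insert e S)))
        = nested W (fun X S T => (if F.lab (insert e X) = 0 ∨ F.lab (insert e X) = 4 then (1 : ℤ) else 0) * kk (F.lab (insert e S)) (F.lab (insert e T))) := by
      rw [nested_swap23, nested_swap12]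
    have htri : 0 ≤ nested W (fun X S T => triP (F.lab (insert e X)) (F.lab (insert e S)) (F.lab (insert e T))) := by
      unfold nested
      exact sum_nonneg fun X _ => sum_nonneg fun S _ => triP_nonneg _ _ _
    rw [step, e2, e3]
    linarith
  -- `R ≤ 2P + Q` termwise in the spectator
  have hcore : nested W (fun X S T => (if F.lab (insert e X) = 0 ∨ F.lab (insert e X) = 4 then (1 : ℤ) else 0)
          * kk (F.lab (insert e S)) (F.lab (insert e T)))
      ≤ 2 * nested W (fun X S T => (if F.lab (insert e X) = 0 ∨ F.lab (insert e X) = 4 then (1 : ℤ) else 0) * kk (F.lab (insert e S)) (F.lab T))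
        + nested W (fun X S T => (if F.lab X = 0 ∨ F.lab X = 4 then (1 : ℤ) else 0) * kk (F.lab (insert e S)) (F.lab (insert e T))) := by
    unfold nested
    rw [mul_sum, ← sum_add_distrib]
    refine sum_le_sum fun X _ => ?_
    rw [← mul_sum, ← mul_sum, ← mul_sum]
    have h10 := F.antipodal_insert_nonneg (W \ X) e
    have h11 := F.antipodal_insert_insert_nonneg (W \ X) e
    have hle := F.antipodal_insert_insert_le_two_mul_insert (W \ X) e
    by_cases h0 : (F.lab X = 0 ∨ F.lab X = 4) <;> by_cases h1 : (F.lab (insert e X) = 0 ∨ F.lab (insert e X) = 4) <;>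
      simp only [h0, h1, if_true, if_false] <;> linarith
  linarith

end Sunflower

end Summit.CriticalPhenomena.PercolationContinuityZ3.Theorems.SunflowerPartition
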